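import Summits.RiemannHypothesis.RiemannHypothesis.Theorems.SemilocalDeletionCliff
import Summits.RiemannHypothesis.RiemannHypothesis.Theorems.HandoffSemilocalEnergy
import Literature.NumberTheory.LFunctions.WeilSemilocalNegative
import HarnessLib

/-!
# The deletion cliff floor for SEVERAL primes: `Re Q_{S∖D}(g) ≥ Re Q_S(g) − (Σ_{p∈D} log p/√p)‖g‖₂²`

Iterating `SemilocalDeletionCliff.re_weilSemilocalQuadratic_erase_ge` over a finite set `D ⊆ S` of primes, each with
`c < log p` (so each deleted prime is a single visible atom on the window of `k = g ⋆ g̃`): the cost of deleting `D` is at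
most the SUM of the single-atom weights.  Numerics (rh-explicit cell, cc-s2-1 gen9, b = 1.8, lineage E certified, BLIND
under PREREG-ccs21-g9-laggraph18): the free-odd bottoms reach 81–98 % of this floor for 2- and 3-prime deletions
(98 % when the deleted lags cluster within a bump width, e.g. {17, 19}: −1.3274 vs floor −1.3627).
Nothing here bears on RH.
-/

set_option linter.dupNamespace false

noncomputable section

open Complex Filter Set MeasureTheory
open scoped Real Topology ComplexConjugate

namespace Summit.RiemannHypothesis.RiemannHypothesis.Theorems.SemilocalDeletionCliff

open Literature.NumberTheory.LFunctions

variable {g : ℝ → ℂ}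

/-- **Multi-prime deletion floor.** For a finite set `D ⊆ S` of primes with `c < log p` for every `p ∈ D` and a test
function supported in `[−c, c]`: `Re Q_{S∖D}(g) ≥ Re Q_S(g) − (Σ_{p∈D} log p/√p)·‖g‖₂²`. -/
theorem re_weilSemilocalQuadratic_sdiff_ge (hg : IsWeilTest g) {c : ℝ} (hsupp : tsupport g ⊆ Icc (-c) c)
    (D : Finset ℕ) {S : Finset ℕ} (hDS : D ⊆ S) (hprime : ∀ p ∈ D, p.Prime) (hlog : ∀ p ∈ D, c < Real.log p) :
    (weilSemilocalQuadratic S g).re - (∑ p ∈ D, Real.log p / Real.sqrt p) * ∫ u : ℝ, ‖g u‖ ^ 2 ≤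
      (weilSemilocalQuadratic (S \ D) g).re := by
  classical
  induction D using Finset.induction_on generalizing S with
  | empty => simp
  | @insert p D hpD ih =>
    have hpS : p ∈ S := hDS (Finset.mem_insert_self p D)
    have hp : p.Prime := hprime p (Finset.mem_insert_self p D)
    have hcp : c < Real.log p := hlog p (Finset.mem_insert_self p D)
    -- delete p first, then D from S.erase p
    have h1 := re_weilSemilocalQuadratic_erase_ge hg hp hpS hsupp hcp
    have hDS' : D ⊆ S.erase p := by
      intro q hq
      exact Finset.mem_erase.2 ⟨fun h ↦ hpD (h ▸ hq), hDS (Finset.mem_insert_of_mem hq)⟩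
    have h2 := ih hDS' (fun q hq ↦ hprime q (Finset.mem_insert_of_mem hq))
      (fun q hq ↦ hlog q (Finset.mem_insert_of_mem hq))
    have hset : S.erase p \ D = S \ insert p D := by
      ext q
      simp only [Finset.mem_sdiff, Finset.mem_erase, Finset.mem_insert, not_or]
      tauto
    rw [hset] at h2
    rw [Finset.sum_insert hpD, add_mul]
    linarith

/-- **Multi-prime floor under Weil positivity.** If `S` contains every prime visible on `C(c)` (`c ≤ (log (N+1))/2`) and
Weil positivity holds on `C(c)`, then deleting a set `D ⊆ S` of primes with `log p > c` leaves
`Re Q_{S∖D}(g) ≥ −(Σ_{p∈D} log p/√p)‖g‖₂²`. -/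
theorem re_weilSemilocalQuadratic_sdiff_ge_of_weilPositivityOn (hg : IsWeilTest g) {S : Finset ℕ} {N : ℕ}
    (hS : ∀ n ≤ N, IsPrimePow n → n.primeFactors ⊆ S) {c : ℝ} (hcN : c ≤ Real.log ((N : ℝ) + 1) / 2)
    (hpos : WeilPositivityOn c) (hsupp : tsupport g ⊆ Icc (-c) c)
    (D : Finset ℕ) (hDS : D ⊆ S) (hprime : ∀ p ∈ D, p.Prime) (hlog : ∀ p ∈ D, c < Real.log p) :
    -((∑ p ∈ D, Real.log p / Real.sqrt p) * ∫ u : ℝ, ‖g u‖ ^ 2) ≤ (weilSemilocalQuadratic (S \ D) g).re := by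
  have h1 := re_weilSemilocalQuadratic_sdiff_ge hg hsupp D hDS hprime hlog
  have hfull : weilSemilocalQuadratic S g = weilQuadratic g :=
    weilSemilocalQuadratic_eq_weilQuadratic_of_forall hg hS (hsupp.trans (Icc_subset_Icc (by linarith) hcN))
  have h0 : 0 ≤ (weilSemilocalQuadratic S g).re := by rw [hfull]; exact hpos g hg hsupp
  linarith

/-! ## §2  ALL visible powers, ALL windows (appended, cc-s2-1 gen13): `|λ_min(S∖p; c; P) − λ_min(S; c; P)| ≤ 2·log p/(√p − 1)`

Deleting `p ∈ S` changes the coefficient only at the powers `p^d` (by `log p/√(p^d)`); summing Bombieri's `|k(x)| ≤ ‖g‖₂²` over the visible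
powers and the geometric series `Σ_{d≥1} p^{−d/2} = 1/(√p − 1)` gives a WINDOW-FREE two-sided modulus (the m → ∞ value of the Toeplitz
ceiling `SemilocalDeletionToeplitzCeiling`; the sharp per-window constants are `−λ_min(A_m(p))` below / `λ_max(A_m(p))` above). -/

open Summit.RiemannHypothesis.RiemannHypothesis.Theorems.HandoffSemilocalEnergy

variable {S : Finset ℕ} {p : ℕ}

/-- Deleting `p` does not change the coefficient at `n` unless `n` is a positive power of `p`. -/
theorem weilSemilocalCoeff_sub_erase_eq_zero {n : ℕ} (hn : ∀ d : ℕ, d ≠ 0 → n ≠ p ^ d) :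
    weilSemilocalCoeff S n - weilSemilocalCoeff (S.erase p) n = 0 := by
  by_cases hpp : IsPrimePow n
  · obtain ⟨q, m, hq, hm, rfl⟩ := (isPrimePow_nat_iff _).1 hpp
    have hqp : q ≠ p := fun h ↦ hn m hm.ne' (by rw [h])
    rw [weilSemilocalCoeff_erase_prime_pow_of_ne S hq hm.ne' hqp, sub_self]
  · rw [weilSemilocalCoeff_of_not_isPrimePow S hpp, weilSemilocalCoeff_of_not_isPrimePow (S.erase p) hpp, sub_self]

/-- At a positive power of the deleted prime: `Λ_S(p^d)/√(p^d) − Λ_{S∖p}(p^d)/√(p^d) = log p/√(p^d)` (`p ∈ S`). -/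
theorem weilSemilocalCoeff_sub_erase_prime_pow (hp : p.Prime) (hpS : p ∈ S) {d : ℕ} (hd : d ≠ 0) :
    weilSemilocalCoeff S (p ^ d) - weilSemilocalCoeff (S.erase p) (p ^ d) = Real.log p / Real.sqrt ((p : ℝ) ^ d) := by
  unfold weilSemilocalCoeff
  have h1 : (p ^ d).primeFactors ⊆ S := by
    rw [Nat.primeFactors_prime_pow hd hp, Finset.singleton_subset_iff]; exact hpS
  have h2 : ¬ (p ^ d).primeFactors ⊆ S.erase p := by
    rw [Nat.primeFactors_prime_pow hd hp, Finset.singleton_subset_iff]; exact Finset.notMem_erase p S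
  rw [if_pos h1, if_neg h2, ArithmeticFunction.vonMangoldt_apply_pow hd, ArithmeticFunction.vonMangoldt_apply_prime hp,
    sub_zero]
  push_cast
  rfl

/-- The deleted weights are nonnegative. -/
theorem weilSemilocalCoeff_sub_erase_nonneg (p n : ℕ) : 0 ≤ weilSemilocalCoeff S n - weilSemilocalCoeff (S.erase p) n := by
  by_cases h' : n.primeFactors ⊆ S.erase p
  · have hS : n.primeFactors ⊆ S := h'.trans (Finset.erase_subset p S)
    unfold weilSemilocalCoeff
    rw [if_pos h', if_pos hS, sub_self]
  · have : weilSemilocalCoeff (S.erase p) n = 0 := by unfold weilSemilocalCoeff; rw [if_neg h']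
    rw [this, sub_zero]
    exact weilSemilocalCoeff_nonneg S n

/-- `√(p^d) = (√p)^d`. -/
theorem sqrt_natCast_pow (p d : ℕ) : Real.sqrt ((p : ℝ) ^ d) = Real.sqrt p ^ d := by
  induction d with
  | zero => simp
  | succ d ih => rw [pow_succ, Real.sqrt_mul (by positivity), ih, pow_succ]

/-- **The visible mass of one prime is below its all-window mass**: for `p ∈ S` prime and every `N`,
`Σ_{n ≤ N} (Λ_S(n) − Λ_{S∖p}(n))/√n ≤ log p/(√p − 1)` (`= Σ_{d ≥ 1} log p·p^{−d/2}`). -/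
theorem sum_weilSemilocalCoeff_sub_erase_le (hp : p.Prime) (hpS : p ∈ S) (N : ℕ) :
    ∑ n ∈ Finset.range (N + 1), (weilSemilocalCoeff S n - weilSemilocalCoeff (S.erase p) n) ≤
      Real.log p / (Real.sqrt p - 1) := by
  classical
  set w : ℕ → ℝ := fun n ↦ weilSemilocalCoeff S n - weilSemilocalCoeff (S.erase p) n with hw
  have hw0 : ∀ n, 0 ≤ w n := fun n ↦ weilSemilocalCoeff_sub_erase_nonneg (S := S) p n
  set e : ℕ → ℕ := fun d ↦ p ^ (d + 1) with he
  have heinj : Function.Injective e := fun a b h ↦ by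
    have := Nat.pow_right_injective hp.two_le h
    simpa using this
  set I : Finset ℕ := (Finset.range N).image e with hI
  have hzero : ∀ n ∈ Finset.range (N + 1), n ∉ I → w n = 0 := by
    intro n hn hnI
    refine weilSemilocalCoeff_sub_erase_eq_zero (S := S) (p := p) fun d hd hnd ↦ hnI ?_
    rw [hI, Finset.mem_image]
    refine ⟨d - 1, ?_, ?_⟩
    · rw [Finset.mem_range] at hn ⊢
      have hlt : d < p ^ d := Nat.lt_pow_self hp.one_lt
      omega
    · rw [he]; dsimp only; rw [Nat.sub_add_cancel (Nat.one_le_iff_ne_zero.2 hd), hnd]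
  have hsplit : ∑ n ∈ Finset.range (N + 1), w n = ∑ n ∈ (Finset.range (N + 1)).filter (· ∈ I), w n := by
    rw [← Finset.sum_filter_add_sum_filter_not (Finset.range (N + 1)) (· ∈ I) w]
    have : ∑ n ∈ (Finset.range (N + 1)).filter (fun n ↦ ¬ n ∈ I), w n = 0 :=
      Finset.sum_eq_zero fun n hn ↦ by
        rw [Finset.mem_filter] at hn
        exact hzero n hn.1 hn.2
    rw [this, add_zero]
  have hsub : (Finset.range (N + 1)).filter (· ∈ I) ⊆ I := fun n hn ↦ (Finset.mem_filter.1 hn).2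
  have hle1 : ∑ n ∈ (Finset.range (N + 1)).filter (· ∈ I), w n ≤ ∑ n ∈ I, w n :=
    Finset.sum_le_sum_of_subset_of_nonneg hsub fun n _ _ ↦ hw0 n
  have himage : ∑ n ∈ I, w n = ∑ d ∈ Finset.range N, w (e d) := by
    rw [hI, Finset.sum_image fun a _ b _ h ↦ heinj h]
  set ρ : ℝ := (Real.sqrt p)⁻¹ with hρ
  have hsqrt1 : 1 < Real.sqrt p := by
    rw [show (1 : ℝ) = Real.sqrt 1 by simp]
    exact Real.sqrt_lt_sqrt (by norm_num) (by exact_mod_cast hp.one_lt)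
  have hsqrt0 : 0 < Real.sqrt p := by linarith
  have hρ0 : 0 ≤ ρ := by positivity
  have hρ1 : ρ < 1 := by rw [hρ]; exact inv_lt_one_of_one_lt₀ hsqrt1
  have hlog : 0 ≤ Real.log p := Real.log_nonneg (by exact_mod_cast hp.one_lt.le)
  have hterm : ∀ d : ℕ, w (e d) = Real.log p * ρ ^ (d + 1) := by
    intro d
    rw [hw, he]; dsimp only
    rw [weilSemilocalCoeff_sub_erase_prime_pow (S := S) hp hpS (Nat.succ_ne_zero d), sqrt_natCast_pow, hρ, inv_pow,
      div_eq_mul_inv]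
  have hgeom : ∑ d ∈ Finset.range N, ρ ^ (d + 1) ≤ ρ / (1 - ρ) := by
    have hsum : ∑ d ∈ Finset.range N, ρ ^ (d + 1) = ρ * ∑ d ∈ Finset.range N, ρ ^ d := by
      rw [Finset.mul_sum]
      refine Finset.sum_congr rfl fun d _ ↦ by ring
    rw [hsum, geom_sum_eq hρ1.ne N]
    have h1 : 0 < 1 - ρ := by linarith
    have hnum : (ρ ^ N - 1) / (ρ - 1) = (1 - ρ ^ N) / (1 - ρ) := by
      rw [← neg_sub 1 (ρ ^ N), ← neg_sub 1 ρ, neg_div_neg_eq]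
    rw [hnum, ← mul_div_assoc]
    have : 0 ≤ ρ ^ N := pow_nonneg hρ0 N
    exact div_le_div_of_nonneg_right (by nlinarith) h1.le
  have hρfrac : ρ / (1 - ρ) = 1 / (Real.sqrt p - 1) := by
    rw [hρ]
    field_simp
  calc ∑ n ∈ Finset.range (N + 1), w n
      = ∑ n ∈ (Finset.range (N + 1)).filter (· ∈ I), w n := hsplit
    _ ≤ ∑ n ∈ I, w n := hle1
    _ = ∑ d ∈ Finset.range N, Real.log p * ρ ^ (d + 1) := by rw [himage]; exact Finset.sum_congr rfl fun d _ ↦ hterm d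
    _ = Real.log p * ∑ d ∈ Finset.range N, ρ ^ (d + 1) := by rw [Finset.mul_sum]
    _ ≤ Real.log p * (ρ / (1 - ρ)) := mul_le_mul_of_nonneg_left hgeom hlog
    _ = Real.log p / (Real.sqrt p - 1) := by rw [hρfrac, mul_one_div]

/-- **ALL-WINDOW modulus at the Rayleigh level.** For `p ∈ S` prime and a test function on ANY window `[−c, c]`:
`|Re Q_{S∖p}(g) − Re Q_S(g)| ≤ 2·(log p/(√p − 1))·‖g‖₂²` (every visible power `p^d` contributes `(log p/√(p^d))·|k(d log p) + k(−d log p)|`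
with Bombieri's `|k| ≤ ‖g‖₂²`). -/
theorem abs_re_weilSemilocalQuadratic_erase_sub_le_allWindow (hg : IsWeilTest g) (hp : p.Prime) (hpS : p ∈ S) {c : ℝ}
    (hsupp : tsupport g ⊆ Icc (-c) c) :
    |(weilSemilocalQuadratic (S.erase p) g).re - (weilSemilocalQuadratic S g).re| ≤
      2 * (Real.log p / (Real.sqrt p - 1)) * ∫ u : ℝ, ‖g u‖ ^ 2 := by
  set N : ℕ := ⌊Real.exp (2 * c)⌋₊ with hNdef
  have hN : 2 * c < Real.log ((N : ℝ) + 1) := by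
    rw [Real.lt_log_iff_exp_lt (by positivity)]
    exact Nat.lt_floor_add_one _
  set k := weilConv g (weilReflect g) with hkdef
  have hk : IsWeilTest k := hg.weilConv hg.weilReflect
  have hks : tsupport k ⊆ Icc (-Real.log ((N : ℝ) + 1)) (Real.log ((N : ℝ) + 1)) :=
    (tsupport_weilConv_weilReflect_subset (a := c) hg.2 hsupp).trans (Icc_subset_Icc (by linarith) (by linarith))
  have hS := weilSemilocalPrimeTerm_eq_sum_of_tsupport_subset S hk.1.continuous N hks
  have hS' := weilSemilocalPrimeTerm_eq_sum_of_tsupport_subset (S.erase p) hk.1.continuous N hks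
  -- the difference of the two forms is the weighted atom sum
  have hdiff : weilSemilocalQuadratic (S.erase p) g - weilSemilocalQuadratic S g =
      ∑ n ∈ Finset.range (N + 1), (((weilSemilocalCoeff S n - weilSemilocalCoeff (S.erase p) n : ℝ)) : ℂ) *
        (k (Real.log n) + k (-Real.log n)) := by
    have hpt : weilSemilocalPrimeTerm S k - weilSemilocalPrimeTerm (S.erase p) k =
        ∑ n ∈ Finset.range (N + 1), (((weilSemilocalCoeff S n - weilSemilocalCoeff (S.erase p) n : ℝ)) : ℂ) *
          (k (Real.log n) + k (-Real.log n)) := by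
      rw [hS, hS', ← Finset.sum_sub_distrib]
      refine Finset.sum_congr rfl fun n _ ↦ ?_
      push_cast
      ring
    unfold weilSemilocalQuadratic weilSemilocalFunctional
    rw [← hkdef]
    linear_combination hpt
  have hre : (weilSemilocalQuadratic (S.erase p) g).re - (weilSemilocalQuadratic S g).re =
      ∑ n ∈ Finset.range (N + 1), (weilSemilocalCoeff S n - weilSemilocalCoeff (S.erase p) n) *
        (k (Real.log n) + k (-Real.log n)).re := by
    have := congrArg Complex.re hdiff
    rw [Complex.sub_re, Complex.re_sum] at this
    rw [this]
    exact Finset.sum_congr rfl fun n _ ↦ by rw [Complex.re_ofReal_mul]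
  -- each atom is bounded by twice the mass
  have hK : ∀ n : ℕ, |(k (Real.log n) + k (-Real.log n)).re| ≤ 2 * ∫ u : ℝ, ‖g u‖ ^ 2 := by
    intro n
    have h1 := norm_weilConv_weilReflect_le hg (Real.log n)
    have h2 := norm_weilConv_weilReflect_le hg (-Real.log n)
    calc |(k (Real.log n) + k (-Real.log n)).re| ≤ ‖k (Real.log n) + k (-Real.log n)‖ := abs_re_le_norm _
      _ ≤ ‖k (Real.log n)‖ + ‖k (-Real.log n)‖ := norm_add_le _ _
      _ ≤ 2 * ∫ u : ℝ, ‖g u‖ ^ 2 := by rw [hkdef] at *; linarith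
  have hsum : |∑ n ∈ Finset.range (N + 1), (weilSemilocalCoeff S n - weilSemilocalCoeff (S.erase p) n) *
        (k (Real.log n) + k (-Real.log n)).re| ≤
      ∑ n ∈ Finset.range (N + 1), (weilSemilocalCoeff S n - weilSemilocalCoeff (S.erase p) n) *
        (2 * ∫ u : ℝ, ‖g u‖ ^ 2) := by
    refine (Finset.abs_sum_le_sum_abs _ _).trans (Finset.sum_le_sum fun n _ ↦ ?_)
    rw [abs_mul, abs_of_nonneg (weilSemilocalCoeff_sub_erase_nonneg (S := S) p n)]
    exact mul_le_mul_of_nonneg_left (hK n) (weilSemilocalCoeff_sub_erase_nonneg (S := S) p n)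
  rw [hre]
  refine hsum.trans ?_
  rw [← Finset.sum_mul]
  have hm : 0 ≤ 2 * ∫ u : ℝ, ‖g u‖ ^ 2 := by
    have h0 : 0 ≤ ∫ u : ℝ, ‖g u‖ ^ 2 := integral_nonneg fun u ↦ by positivity
    linarith
  have := mul_le_mul_of_nonneg_right (sum_weilSemilocalCoeff_sub_erase_le (S := S) hp hpS N) hm
  linarith

variable {P : (ℝ → ℂ) → Prop}

/-- **ALL-WINDOW MODULUS (energy form).** For `p ∈ S` prime, EVERY window `c` and every constraint `P`:
`|λ_min(S∖p; c; P) − λ_min(S; c; P)| ≤ 2·log p/(√p − 1)` (constants `3.3468` (p = 2), `3.0015` (3), `2.6041` (5), `2.3648` (7), `2.0702` (11)). -/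
theorem abs_semilocalGroundEnergy_erase_sub_le_allWindow (hp : p.Prime) (hpS : p ∈ S) (c : ℝ) :
    |semilocalGroundEnergy (S.erase p) P c - semilocalGroundEnergy S P c| ≤ 2 * (Real.log p / (Real.sqrt p - 1)) := by
  set M : ℝ := 2 * (Real.log p / (Real.sqrt p - 1)) with hM
  have hsqrt1 : 1 < Real.sqrt p := by
    rw [show (1 : ℝ) = Real.sqrt 1 by simp]
    exact Real.sqrt_lt_sqrt (by norm_num) (by exact_mod_cast hp.one_lt)
  have hM0 : 0 ≤ M := by
    have := Real.log_nonneg (show (1 : ℝ) ≤ p by exact_mod_cast hp.one_lt.le)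
    rw [hM]; exact mul_nonneg zero_le_two (div_nonneg this (by linarith))
  have hray : ∀ g : ℝ → ℂ, IsWeilTest g → tsupport g ⊆ Icc (-c) c → ∫ u : ℝ, ‖g u‖ ^ 2 = 1 →
      |(weilSemilocalQuadratic (S.erase p) g).re - (weilSemilocalQuadratic S g).re| ≤ M := by
    intro g hg hs hn
    have h := abs_re_weilSemilocalQuadratic_erase_sub_le_allWindow hg hp hpS hs
    rwa [hn, mul_one] at h
  rcases (semilocalSphereValues S P c).eq_empty_or_nonempty with he | hne
  · have he' : semilocalSphereValues (S.erase p) P c = ∅ := by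
      rcases (semilocalSphereValues (S.erase p) P c).eq_empty_or_nonempty with h0 | h0
      · exact h0
      · have := (semilocalSphereValues_nonempty_iff (S.erase p) P c).1 h0
        rw [← semilocalSphereValues_nonempty_iff S P c, he] at this
        exact absurd this Set.not_nonempty_empty
    rw [semilocalGroundEnergy, semilocalGroundEnergy, he, he', Real.sInf_empty, sub_self, abs_zero]
    exact hM0
  · have hne' : (semilocalSphereValues (S.erase p) P c).Nonempty := by
      rwa [semilocalSphereValues_nonempty_iff (S.erase p) P c, ← semilocalSphereValues_nonempty_iff S P c]
    have hlo : semilocalGroundEnergy S P c - M ≤ semilocalGroundEnergy (S.erase p) P c := by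
      refine le_semilocalGroundEnergy hne' fun g hg hs hPg hn ↦ ?_
      have h1 := (abs_le.1 (hray g hg hs hn)).1
      have h2 := semilocalGroundEnergy_le_re (S := S) hg hs hPg hn
      linarith
    have hhi : semilocalGroundEnergy (S.erase p) P c - M ≤ semilocalGroundEnergy S P c := by
      refine le_semilocalGroundEnergy hne fun g hg hs hPg hn ↦ ?_
      have h1 := (abs_le.1 (hray g hg hs hn)).2
      have h2 := semilocalGroundEnergy_le_re (S := S.erase p) hg hs hPg hn
      linarith
    exact abs_le.2 ⟨by linarith, by linarith⟩

/-- **LIPSCHITZ LAW IN THE PRIME SET (all windows, RH-free).** For primes `T ⊆ S`, every window `c` and every constraint `P`: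
`|λ_min(S∖T; c; P) − λ_min(S; c; P)| ≤ Σ_{p∈T} 2·log p/(√p − 1)`. -/
theorem abs_semilocalGroundEnergy_sdiff_sub_le_allWindow {T : Finset ℕ} (hTS : T ⊆ S) (hT : ∀ p ∈ T, p.Prime) (c : ℝ) :
    |semilocalGroundEnergy (S \ T) P c - semilocalGroundEnergy S P c| ≤ ∑ p ∈ T, 2 * (Real.log p / (Real.sqrt p - 1)) := by
  classical
  induction T using Finset.induction_on with
  | empty => simp
  | @insert q T hqT ih =>
    have hqS : q ∈ S := hTS (Finset.mem_insert_self q T)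
    have hTS' : T ⊆ S := (Finset.subset_insert q T).trans hTS
    have ih' := ih hTS' fun p hp ↦ hT p (Finset.mem_insert_of_mem hp)
    have hq : q.Prime := hT q (Finset.mem_insert_self q T)
    have hqST : q ∈ S \ T := Finset.mem_sdiff.2 ⟨hqS, hqT⟩
    have hstep := abs_semilocalGroundEnergy_erase_sub_le_allWindow (S := S \ T) (P := P) hq hqST c
    rw [Finset.sdiff_insert, Finset.sum_insert hqT]
    rw [abs_le] at hstep ih' ⊢
    constructor <;> linarith [hstep.1, hstep.2, ih'.1, ih'.2]

/-! ## §3  RH-facing form of the all-window law (appended, cc-s2-1 gen13): ALL-WINDOW FALSIFIERS -/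

/-- **RH ⇒ all-window floor for deleted families.** If `S` contains the prime factors of every prime power `n ≤ N`, `0 < c ≤ (log (N+1))/2`,
`T ⊆ S` consists of primes, the constraint `P` is stable under positive scaling and RH holds, then
`λ_min(S∖T; c; P) ≥ −Σ_{p∈T} 2·log p/(√p − 1)` — at EVERY window, however many powers of the deleted primes are visible
(`SemilocalDeletionCliffFalsifiers` has the single-visibility constant `−Σ log p/√p` for `c < log p` only). -/
theorem semilocalGroundEnergy_sdiff_ge_neg_allWindow_of_riemannHypothesis (hRH : Summit.RiemannHypothesis) {N : ℕ}
    (hS : ∀ n ≤ N, IsPrimePow n → n.primeFactors ⊆ S) {c : ℝ} (hc : 0 < c) (hcN : c ≤ Real.log ((N : ℝ) + 1) / 2)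
    {T : Finset ℕ} (hTS : T ⊆ S) (hT : ∀ p ∈ T, p.Prime)
    (hP : ∀ (a : ℝ) (g : ℝ → ℂ), 0 < a → P g → P fun t ↦ (a : ℂ) * g t) :
    -∑ p ∈ T, 2 * (Real.log p / (Real.sqrt p - 1)) ≤ semilocalGroundEnergy (S \ T) P c := by
  have hpos : WeilSemilocalPositivityOn S c :=
    (MotivicDoor.Semilocal.weilSemilocalPositivityOn_iff_weilPositivityOn_of_le hS hcN).2
      ((riemannHypothesis_iff_forall_weilPositivityOn.1 (Summit.RiemannHypothesis_iff.1 hRH)) c hc)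
  have h0 : 0 ≤ semilocalGroundEnergy S P c := (semilocalGroundEnergy_nonneg_iff hP).2 fun g hg hs _ ↦ hpos g hg hs
  have h1 := (abs_le.1 (abs_semilocalGroundEnergy_sdiff_sub_le_allWindow (S := S) (P := P) hTS hT c)).1
  linarith

/-- **ALL-WINDOW FALSIFIER.** With `S ⊇ {prime factors of prime powers ≤ N}`, `0 < c ≤ (log (N+1))/2`, primes `T ⊆ S`, `P` scaling-stable:
a semi-local bottom `λ_min(S∖T; c; P) < −Σ_{p∈T} 2·log p/(√p − 1)` REFUTES RH (e.g. a certified finite-section value below that line, after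
transfer to the continuum bottom). Every lineage-E cell so far sits far above it (deleted bottoms ≥ −1.09 vs −3.35 for T = {2}). -/
theorem not_riemannHypothesis_of_semilocalGroundEnergy_sdiff_lt_allWindow {N : ℕ}
    (hS : ∀ n ≤ N, IsPrimePow n → n.primeFactors ⊆ S) {c : ℝ} (hc : 0 < c) (hcN : c ≤ Real.log ((N : ℝ) + 1) / 2)
    {T : Finset ℕ} (hTS : T ⊆ S) (hT : ∀ p ∈ T, p.Prime)
    (hP : ∀ (a : ℝ) (g : ℝ → ℂ), 0 < a → P g → P fun t ↦ (a : ℂ) * g t)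
    (hlt : semilocalGroundEnergy (S \ T) P c < -∑ p ∈ T, 2 * (Real.log p / (Real.sqrt p - 1))) :
    ¬ Summit.RiemannHypothesis := fun hRH ↦ by
  have h := semilocalGroundEnergy_sdiff_ge_neg_allWindow_of_riemannHypothesis (P := P) hRH hS hc hcN hTS hT hP
  linarith

/-! ## §4  UNIVERSAL RH floor for EVERY finite prime set at EVERY window (appended, cc-s2-1 gen13) -/

/-- **RH ⇒ every finite set of primes has its bottom above minus the all-window masses of the MISSING visible primes.**
For any finite `S'`, any window `c > 0` and any scaling-stable constraint `P`:
`λ_min(S'; c; P) ≥ −Σ_{p prime, p ≤ ⌊e^{2c}⌋, p ∉ S'} 2·log p/(√p − 1)` — take `S = S' ∪ {primes ≤ e^{2c}}` (visible-complete) in §3.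
Example: the PRIME-FREE form (`S' = ∅`) satisfies `λ_min(∅; c) ≥ −Σ_{p ≤ e^{2c}} 2·log p/(√p − 1)` at every window if RH holds. -/
theorem semilocalGroundEnergy_ge_neg_missing_allWindow_of_riemannHypothesis (hRH : Summit.RiemannHypothesis) (S' : Finset ℕ)
    {c : ℝ} (hc : 0 < c) (hP : ∀ (a : ℝ) (g : ℝ → ℂ), 0 < a → P g → P fun t ↦ (a : ℂ) * g t) :
    -∑ p ∈ ((Finset.range (⌊Real.exp (2 * c)⌋₊ + 1)).filter Nat.Prime) \ S', 2 * (Real.log p / (Real.sqrt p - 1)) ≤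
      semilocalGroundEnergy S' P c := by
  classical
  set N : ℕ := ⌊Real.exp (2 * c)⌋₊ with hNdef
  set V : Finset ℕ := (Finset.range (N + 1)).filter Nat.Prime with hV
  have hcN : c ≤ Real.log ((N : ℝ) + 1) / 2 := by
    have : 2 * c < Real.log ((N : ℝ) + 1) := by
      rw [Real.lt_log_iff_exp_lt (by positivity)]; exact Nat.lt_floor_add_one _
    linarith
  -- S := S' ∪ V is visible-complete, T := V \ S' ⊆ S consists of primes, and S \ T = S'
  have hS : ∀ n ≤ N, IsPrimePow n → n.primeFactors ⊆ S' ∪ V := by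
    intro n hn _ q hq
    refine Finset.mem_union_right _ (Finset.mem_filter.2 ⟨Finset.mem_range.2 ?_, Nat.prime_of_mem_primeFactors hq⟩)
    have := Nat.le_of_mem_primeFactors hq
    omega
  have hTS : V \ S' ⊆ S' ∪ V := fun q hq ↦ Finset.mem_union_right _ (Finset.mem_sdiff.1 hq).1
  have hT : ∀ q ∈ V \ S', q.Prime := fun q hq ↦ (Finset.mem_filter.1 (Finset.mem_sdiff.1 hq).1).2
  have hset : (S' ∪ V) \ (V \ S') = S' := by
    ext q
    simp only [Finset.mem_sdiff, Finset.mem_union]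
    tauto
  have h := semilocalGroundEnergy_sdiff_ge_neg_allWindow_of_riemannHypothesis (P := P) hRH hS hc hcN hTS hT hP
  rwa [hset] at h

/-- **Universal all-window falsifier.** A finite prime set `S'`, a window `c > 0` and a scaling-stable `P` with
`λ_min(S'; c; P) < −Σ_{p prime ≤ ⌊e^{2c}⌋, p ∉ S'} 2·log p/(√p − 1)` refute RH. -/
theorem not_riemannHypothesis_of_semilocalGroundEnergy_lt_neg_missing (S' : Finset ℕ) {c : ℝ} (hc : 0 < c)
    (hP : ∀ (a : ℝ) (g : ℝ → ℂ), 0 < a → P g → P fun t ↦ (a : ℂ) * g t)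
    (hlt : semilocalGroundEnergy S' P c <
      -∑ p ∈ ((Finset.range (⌊Real.exp (2 * c)⌋₊ + 1)).filter Nat.Prime) \ S', 2 * (Real.log p / (Real.sqrt p - 1))) :
    ¬ Summit.RiemannHypothesis := fun hRH ↦ by
  have h := semilocalGroundEnergy_ge_neg_missing_allWindow_of_riemannHypothesis (P := P) hRH S' hc hP
  linarith

end Summit.RiemannHypothesis.RiemannHypothesis.Theorems.SemilocalDeletionCliff

end
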